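import Literature.Geometry.Riemannian.LinearHeatForcedExistence
import Literature.Geometry.Riemannian.LinearHeatBorel
import HarnessLib

/-!
# The linear heat-type Cauchy problem on a closed manifold: smooth solutions up to `s = 0`

Final step of the solvability of the linear heat-type Cauchy problem
`∂ₛw = Δ_{h(s)}w − Qw`, `w(0) = w₀`, on a closed manifold `M` modelled on `ℝᵐ`, for a family of
Riemannian metrics `h(s)` and a potential `Q` which are `C^∞` on `M × ℝ` and a `C^∞` datum
`w₀`: **there is a solution `C^∞` on `M × (−∞, b)` ⊇ `M × [0, T]` with `w(0) = w₀`, solving the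
equation (two-sided time derivative) at every `s ∈ [0, b)`** — the standard existence theorem of
linear parabolic theory (Friedman 1964, Ch. 3, Thm. 7; Trèves 1975, §41, Thm. 40.1;
Topping 2006, Rem. 8.2.5), INCLUDING smoothness up to the initial time. Assembly:

* `exists_flat_corrector` (`LinearHeatBorel.lean`, Borel summation of the formal power series
  solution): `W`, `G` smooth on `M × ℝ`, `W(0) = w₀`, `G = 0` for `s ≤ 0`,
  `G = −(∂ₛW − Δ_{h(s)}W + QW)` for `s ≥ 0`;
* `exists_smooth_linearHeat_forcing` (`LinearHeatForcedExistence.lean`: Lions' very weak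
  solution, Hörmander's hypoellipticity, uniqueness): under the coercivity condition
  `ρ + ½∂ₛρ ≤ ρQ` a solution `v` of `∂ₛv = Δv − Qv + G`, smooth on `M × (−∞, b)`, vanishing for
  `s ≤ 0`; then `w = W + v` (`exists_smooth_linearHeat_cauchy_of_coercive`);
* the coercivity condition is arranged by the exponential shift `w = e^{λs} w̃`,
  `Q̃ = Q + λ` (Trèves (41.9)), `λ` a bound of `(ρ + ½∂ₛρ)/ρ − Q` on the compact `M × [−1, b]`
  (`exists_smooth_linearHeat_cauchy`);
* corollaries in the two forms consumed by the tree: `exists_linearHeat_Icc` (the conclusion of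
  the `hLP` hypothesis of `perelman_noLocalCollapsing_of_linearHeat` for families smooth on
  `M × ℝ`) and `exists_staticLinearHeat` (VERBATIM the hypothesis `hLPM` of
  `heatDrift_finite_of_staticLinearHeat` / `hLPs` of
  `carrilloNi_muEntropy_eq_log_shrinkerDensity_of_staticLinearHeat` for the models `ℝᵐ`).

Everything is proved; no definitions, no named facts.

## References

* A. Friedman, *Partial differential equations of parabolic type*, Prentice-Hall 1964, Ch. 1,
  Thm. 10 and Ch. 3, Thm. 7. [Friedman1964]
* F. Trèves, *Basic Linear Partial Differential Equations*, Academic Press 1975, §41,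
  (41.9), Lemma 41.2, Thm. 40.1. [Treves1975]
* P. Topping, *Lectures on the Ricci flow* (2006), Rem. 8.2.5. [Topping2006]
-/

noncomputable section

open Bundle Set Function Filter Manifold MeasureTheory Measure TopologicalSpace
open scoped Manifold ContDiff Topology ENNReal

namespace Literature.Geometry.Riemannian

open Lorentzian Lorentzian.PseudoRiemannianMetric

variable {m : ℕ} {H : Type*} [TopologicalSpace H]
  {I : ModelWithCorners ℝ (EuclideanSpace ℝ (Fin m)) H} [I.Boundaryless]
  {M : Type*} [TopologicalSpace M] [ChartedSpace H M] [IsManifold I ∞ M]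
  [T2Space M] [CompactSpace M] [SecondCountableTopology M] [MeasurableSpace M] [BorelSpace M]
  {h : ℝ → PseudoRiemannianMetric I ∞ (EuclideanSpace ℝ (Fin m)) (TangentSpace I : M → Type _)}
  {g₀ : PseudoRiemannianMetric I ∞ (EuclideanSpace ℝ (Fin m)) (TangentSpace I : M → Type _)}

/-! ### Linearity of `Δ_g` at a point -/

section Linearity

omit [T2Space M] [CompactSpace M] [SecondCountableTopology M] [MeasurableSpace M]
  [BorelSpace M] in
/-- `Δ_g (f₁ + f₂) = Δ_g f₁ + Δ_g f₂` at a point where both functions are `C²`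
(`dalembertian_add_const_mul`). [folklore] -/
theorem laplaceBeltrami_fun_add
    (g : PseudoRiemannianMetric I ∞ (EuclideanSpace ℝ (Fin m)) (TangentSpace I : M → Type _))
    {f₁ f₂ : M → ℝ} {x : M} (hf₁ : ContMDiffAt I 𝓘(ℝ, ℝ) 2 f₁ x)
    (hf₂ : ContMDiffAt I 𝓘(ℝ, ℝ) 2 f₂ x) :
    g.laplaceBeltrami (fun y ↦ f₁ y + f₂ y) x = g.laplaceBeltrami f₁ x + g.laplaceBeltrami f₂ x := by
  haveI := g.hasLeviCivita
  have h1 := dalembertian_add_const_mul (g := g) (p := x) 1 hf₁ hf₂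
  simp only [one_mul] at h1
  simp only [laplaceBeltrami_eq_dalembertian]
  exact h1

omit [T2Space M] [CompactSpace M] [SecondCountableTopology M] [MeasurableSpace M]
  [BorelSpace M] in
/-- `Δ_g (c f) = c Δ_g f` at a point where `f` is `C²` (`dalembertian_add_const_mul` with
`f₁ = 0`). [folklore] -/
theorem laplaceBeltrami_const_mul
    (g : PseudoRiemannianMetric I ∞ (EuclideanSpace ℝ (Fin m)) (TangentSpace I : M → Type _))
    {f : M → ℝ} {x : M} (hf : ContMDiffAt I 𝓘(ℝ, ℝ) 2 f x) (c : ℝ) :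
    g.laplaceBeltrami (fun y ↦ c * f y) x = c * g.laplaceBeltrami f x := by
  haveI := g.hasLeviCivita
  have h1 := dalembertian_add_const_mul (g := g) (p := x) (f₁ := fun _ ↦ (0 : ℝ)) c
    contMDiffAt_const hf
  have h0 : g.dalembertian (fun _ : M ↦ (0 : ℝ)) x = 0 :=
    g.dalembertian_eq_zero_of_eventuallyEq_zero (Eventually.of_forall fun _ ↦ rfl)
  simp only [zero_add, h0] at h1
  simp only [laplaceBeltrami_eq_dalembertian]
  exact h1

end Linearity

/-! ### The Cauchy problem under the coercivity condition -/

section Coercive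

variable (hh : IsContMDiffFamilyOn ∞ h univ) (hR : ∀ s, (h s).IsRiemannian)
  (hR₀ : g₀.IsRiemannian) {Q : ℝ → M → ℝ}
  (hQ : ContMDiff (I.prod 𝓘(ℝ, ℝ)) 𝓘(ℝ, ℝ) ∞ fun p : M × ℝ ↦ Q p.2 p.1)

include hh hR hR₀ hQ in
/-- **The Cauchy problem under the coercivity condition** `ρ + ½∂ₛρ ≤ ρQ` on `M × [−1, b]`
(`ρ = dV_{h(s)}/dV_{g₀}`, `0 < b`): for every `C^∞` datum `w₀` there is `w`, `C^∞` on
`M × (−∞, b)`, with `w(0) = w₀` and `∂ₛw = Δ_{h(s)}w − Qw` (two-sided time derivative) at every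
`s ∈ [0, b)`. Proof: `w = W + v` with the flat corrector `W` (`exists_flat_corrector`) and the
solution `v` of the forced problem with the flat forcing `G = −(∂ₛW − ΔW + QW)·1_{s ≥ 0}`,
vanishing for `s ≤ 0` (`exists_smooth_linearHeat_forcing`).
[cite: Treves1975, §41, Thm. 40.1] -/
theorem exists_smooth_linearHeat_cauchy_of_coercive {b : ℝ} (hb : 0 < b)
    (hcoer : ∀ (x : M), ∀ s ∈ Icc (-1 : ℝ) b, (h s).densityRatio g₀ x +
      deriv (fun s ↦ (h s).densityRatio g₀ x) s / 2 ≤ (h s).densityRatio g₀ x * Q s x)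
    {w₀ : M → ℝ} (hw₀ : ContMDiff I 𝓘(ℝ, ℝ) ∞ w₀) :
    ∃ w : ℝ → M → ℝ,
      ContMDiffOn (I.prod 𝓘(ℝ, ℝ)) 𝓘(ℝ, ℝ) ∞ (fun p : M × ℝ ↦ w p.2 p.1) (univ ×ˢ Iio b) ∧
      w 0 = w₀ ∧
      ∀ s ∈ Ico 0 b, ∀ x : M, HasDerivAt (fun r ↦ w r x)
        ((h s).laplaceBeltrami (w s) x - Q s x * w s x) s := by
  have h2 : (2 : ℕ∞ω) ≤ ((⊤ : ℕ∞) : ℕ∞ω) := WithTop.coe_le_coe.mpr le_top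
  obtain ⟨W, G, hWs, hGs, hW0, hG0, hGeq⟩ := exists_flat_corrector (I := I) hh hQ hw₀
  obtain ⟨v, hv, hv0, hveq⟩ := exists_smooth_linearHeat_forcing hh hR hR₀ hQ hGs hG0 hb hcoer
  refine ⟨fun s x ↦ W s x + v (x, s), hWs.contMDiffOn.add hv, ?_, ?_⟩
  · funext x
    show W 0 x + v (x, 0) = w₀ x
    rw [hW0, hv0 x 0 le_rfl, add_zero]
  · intro s hs x
    have hdW := hasDerivAt_time (I := I) (F := fun p : M × ℝ ↦ W p.2 p.1) hWs x s
    have hdv := hasDerivAt_slice_of_contMDiffOn isOpen_Iio hv x hs.2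
    have hsum := hdW.add hdv
    rw [hveq x s hs.2, hGeq s hs.1 x] at hsum
    have hW2 : ContMDiffAt I 𝓘(ℝ, ℝ) 2 (W s) x :=
      (((hWs.comp (contMDiff_id.prodMk contMDiff_const)).of_le h2) x :)
    have hv2 : ContMDiffAt I 𝓘(ℝ, ℝ) 2 (fun y ↦ v (y, s)) x :=
      ((contMDiff_slice_of_contMDiffOn (u := fun r y ↦ v (y, r)) hv hs.2).of_le h2) x
    have hΔ := laplaceBeltrami_fun_add (h s) hW2 hv2
    refine hsum.congr_deriv ?_
    show _ = (h s).laplaceBeltrami (fun y ↦ W s y + v (y, s)) x - Q s x * (W s x + v (x, s))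
    rw [hΔ]
    ring

end Coercive

/-! ### The Cauchy problem: exponential shift -/

section Cauchy

variable (hh : IsContMDiffFamilyOn ∞ h univ) (hR : ∀ s, (h s).IsRiemannian) {Q : ℝ → M → ℝ}
  (hQ : ContMDiff (I.prod 𝓘(ℝ, ℝ)) 𝓘(ℝ, ℝ) ∞ fun p : M × ℝ ↦ Q p.2 p.1)

include hh hR hQ in
/-- **Existence of smooth solutions of the linear heat-type Cauchy problem on a closed
manifold, up to the initial time.** Let `h(s)` be a family of Riemannian metrics and `Q` a
potential, `C^∞` on `M × ℝ`, on the closed manifold `M` (modelled on `ℝᵐ`), `0 < b`, and `w₀`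
a `C^∞` datum. Then there is `w : ℝ → M → ℝ`, `C^∞` on `M × (−∞, b)`, with `w(0) = w₀` and
`∂ₛw = Δ_{h(s)}w − Qw` at every `s ∈ [0, b)` (two-sided time derivative, also at `s = 0`).
Proof: with `λ` a bound of `(ρ + ½∂ₛρ)/ρ − Q` on `M × [−1, b]` (`ρ = dV_{h(s)}/dV_{h(0)} > 0`
smooth), the potential `Q + λ` is coercive; solve for it
(`exists_smooth_linearHeat_cauchy_of_coercive`) and multiply by `e^{λs}` (Trèves (41.9)).
[cite: Treves1975, §41, (41.9) and Thm. 40.1] -/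
theorem exists_smooth_linearHeat_cauchy {b : ℝ} (hb : 0 < b)
    {w₀ : M → ℝ} (hw₀ : ContMDiff I 𝓘(ℝ, ℝ) ∞ w₀) :
    ∃ w : ℝ → M → ℝ,
      ContMDiffOn (I.prod 𝓘(ℝ, ℝ)) 𝓘(ℝ, ℝ) ∞ (fun p : M × ℝ ↦ w p.2 p.1) (univ ×ˢ Iio b) ∧
      w 0 = w₀ ∧
      ∀ s ∈ Ico 0 b, ∀ x : M, HasDerivAt (fun r ↦ w r x)
        ((h s).laplaceBeltrami (w s) x - Q s x * w s x) s := by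
  have h2 : (2 : ℕ∞ω) ≤ ((⊤ : ℕ∞) : ℕ∞ω) := WithTop.coe_le_coe.mpr le_top
  have hR₀ : (h 0).IsRiemannian := hR 0
  -- the density ratio and its time derivative are smooth, the ratio is positive
  set ρ : M × ℝ → ℝ := fun p ↦ (h p.2).densityRatio (h 0) p.1 with hρ
  have hρs : ContMDiff (I.prod 𝓘(ℝ, ℝ)) 𝓘(ℝ, ℝ) ∞ ρ := contMDiff_densityRatio_family hh hR hR₀
  have hρt : ContMDiff (I.prod 𝓘(ℝ, ℝ)) 𝓘(ℝ, ℝ) ∞ fun p : M × ℝ ↦ deriv (fun s ↦ ρ (p.1, s)) p.2 :=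
    contMDiff_deriv_time hρs
  have hρpos : ∀ p, 0 < ρ p := fun p ↦ densityRatio_pos (hR p.2) hR₀ p.1
  -- a bound `λ` of `(ρ + ½∂ₛρ)/ρ − Q` on the compact `M × [-1, b]`
  set κ : M × ℝ → ℝ := fun p ↦ (ρ p + deriv (fun s ↦ ρ (p.1, s)) p.2 / 2) / ρ p - Q p.2 p.1
    with hκ
  have hκc : Continuous κ :=
    ((hρs.continuous.add (hρt.continuous.div_const _)).div hρs.continuous
      fun p ↦ (hρpos p).ne').sub hQ.continuous
  obtain ⟨C, hC⟩ := (isCompact_univ.prod (isCompact_Icc (a := (-1 : ℝ)) (b := b))).exists_bound_of_continuousOn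
    hκc.continuousOn
  have hcoer : ∀ (x : M), ∀ s ∈ Icc (-1 : ℝ) b, (h s).densityRatio (h 0) x +
      deriv (fun s ↦ (h s).densityRatio (h 0) x) s / 2 ≤
        (h s).densityRatio (h 0) x * (fun s x ↦ Q s x + C) s x := by
    intro x s hs
    have h1 : κ (x, s) ≤ C := (le_abs_self _).trans ((Real.norm_eq_abs _).symm.le.trans
      (hC (x, s) ⟨mem_univ _, hs⟩))
    have hρ0 : 0 < ρ (x, s) := hρpos (x, s)
    have h3 : ρ (x, s) + deriv (fun s ↦ ρ (x, s)) s / 2 ≤ (C + Q s x) * ρ (x, s) := by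
      rw [← div_le_iff₀ hρ0]
      simp only [hκ] at h1
      linarith
    simp only [hρ] at h3 ⊢
    linarith
  have hQ' : ContMDiff (I.prod 𝓘(ℝ, ℝ)) 𝓘(ℝ, ℝ) ∞ fun p : M × ℝ ↦ (fun s x ↦ Q s x + C) p.2 p.1 :=
    hQ.add contMDiff_const
  obtain ⟨w, hw, hw0, hweq⟩ :=
    exists_smooth_linearHeat_cauchy_of_coercive hh hR hR₀ hQ' hb hcoer hw₀
  have he : ContMDiff (I.prod 𝓘(ℝ, ℝ)) 𝓘(ℝ, ℝ) ∞ fun p : M × ℝ ↦ Real.exp (C * p.2) :=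
    (Real.contDiff_exp.comp (contDiff_const.mul contDiff_id)).comp_contMDiff contMDiff_snd
  refine ⟨fun s x ↦ Real.exp (C * s) * w s x, he.contMDiffOn.mul hw, ?_, ?_⟩
  · funext x
    show Real.exp (C * 0) * w 0 x = w₀ x
    rw [mul_zero, Real.exp_zero, one_mul, hw0]
  · intro s hs x
    have h1 := hweq s hs x
    have h3 : HasDerivAt (fun r ↦ Real.exp (C * r)) (Real.exp (C * s) * C) s := by
      have := ((hasDerivAt_id s).const_mul C).exp
      simpa only [id, mul_one] using this
    have h4 := h3.mul h1
    have hw2 : ContMDiffAt I 𝓘(ℝ, ℝ) 2 (w s) x :=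
      ((contMDiff_slice_of_contMDiffOn hw hs.2).of_le h2) x
    have hΔ := laplaceBeltrami_const_mul (h s) hw2 (Real.exp (C * s))
    refine h4.congr_deriv ?_
    show _ = (h s).laplaceBeltrami (fun y ↦ Real.exp (C * s) * w s y) x -
      Q s x * (Real.exp (C * s) * w s x)
    rw [hΔ]
    ring

include hh hR hQ in
/-- **The linear heat-type Cauchy problem, `[0, T]` form** (the conclusion of the hypothesis
`hLP` of `perelman_noLocalCollapsing_of_linearHeat`, for families and potentials smooth on
`M × ℝ`): for `T > 0` and a `C^∞` datum `w₀` there is `w`, `C^∞` on `M × [0, T]`, with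
`w(0) = w₀` and `∂ₛw = Δ_{h(s)}w − Qw` on `M × [0, T]` (one-sided time derivative within
`[0, T]`). [cite: Friedman1964, Ch. 3, Thm. 7] -/
theorem exists_linearHeat_Icc {T : ℝ} (hT : 0 < T) {w₀ : M → ℝ}
    (hw₀ : ContMDiff I 𝓘(ℝ, ℝ) ∞ w₀) :
    ∃ w : ℝ → M → ℝ,
      ContMDiffOn (I.prod 𝓘(ℝ, ℝ)) 𝓘(ℝ, ℝ) ∞ (fun p : M × ℝ ↦ w p.2 p.1) (univ ×ˢ Icc 0 T) ∧
      w 0 = w₀ ∧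
      ∀ s ∈ Icc 0 T, ∀ x : M, HasDerivWithinAt (fun r ↦ w r x)
        ((h s).laplaceBeltrami (w s) x - Q s x * w s x) (Icc 0 T) s := by
  obtain ⟨w, hw, hw0, hweq⟩ :=
    exists_smooth_linearHeat_cauchy hh hR hQ (b := T + 1) (by linarith) hw₀
  refine ⟨w, hw.mono (prod_mono le_rfl fun s hs ↦ ?_), hw0, fun s hs x ↦
    (hweq s ⟨hs.1, by linarith [hs.2]⟩ x).hasDerivWithinAt⟩
  simp only [mem_Iio]
  linarith [hs.2]

end Cauchy

/-! ### The static problem -/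

section Static

/-- **The static linear heat-type Cauchy problem on a closed manifold modelled on `ℝᵐ`**
(VERBATIM the hypothesis `hLPM` of `heatDrift_finite_of_staticLinearHeat`, and `hLPs` of
`carrilloNi_muEntropy_eq_log_shrinkerDensity_of_staticLinearHeat` at these models): for a
Riemannian metric `g` with Levi-Civita connection, `T > 0`, a smooth potential `Q` and a smooth
datum `w₀`, the problem `∂ₛw = Δ_g w − Q w`, `w(0) = w₀` has a solution `C^∞` on `M × [0, T]`
(one-sided time derivative within `[0, T]`); `exists_linearHeat_Icc` for the constant family.
[cite: Friedman1964, Ch. 3, Thm. 7] -/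
theorem exists_staticLinearHeat
    (g : PseudoRiemannianMetric I ∞ (EuclideanSpace ℝ (Fin m)) (TangentSpace I : M → Type _))
    [g.HasLeviCivita] (hg : g.IsRiemannian) {T : ℝ} (hT : 0 < T) {Q : M → ℝ}
    (hQ : ContMDiff I 𝓘(ℝ, ℝ) ∞ Q) {w₀ : M → ℝ} (hw₀ : ContMDiff I 𝓘(ℝ, ℝ) ∞ w₀) :
    ∃ w : ℝ → M → ℝ,
      ContMDiffOn (I.prod 𝓘(ℝ, ℝ)) 𝓘(ℝ, ℝ) ∞ (fun p : M × ℝ ↦ w p.2 p.1) (univ ×ˢ Icc 0 T) ∧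
      w 0 = w₀ ∧
      ∀ s ∈ Icc 0 T, ∀ x : M, HasDerivWithinAt (fun r ↦ w r x)
        (g.dalembertian (w s) x - Q x * w s x) (Icc 0 T) s := by
  obtain ⟨w, hw, hw0, hweq⟩ := exists_linearHeat_Icc (h := fun _ ↦ g)
    (isContMDiffFamilyOn_const g univ) (fun _ ↦ hg) (Q := fun _ x ↦ Q x)
    (hQ.comp contMDiff_fst) hT hw₀
  refine ⟨w, hw, hw0, fun s hs x ↦ ?_⟩
  have key := hweq s hs x
  rwa [laplaceBeltrami_eq_dalembertian] at key

end Static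

end Literature.Geometry.Riemannian
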